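import Summits.BirchSwinnertonDyer.BirchSwinnertonDyer.Theorems.GenusKolyvaginAtTwoEquivariantKolyvaginExactAtTwoQuadInfResTwist
import Literature.NumberTheory.EllipticCurves.SelmerLevelToPrimary
import Summits.BirchSwinnertonDyer.BirchSwinnertonDyer.Theorems.SchneiderFreeAdditiveX3KYReadEmbAtCompat
import HarnessLib

/-!
# Route `GenusKolyvaginAtTwo`, LINE 6, KEY crux Q3 `EquivariantKolyvaginExactAtTwo`
# (stmt-BirchSwinnertonDyer-24882): KOLYVAGIN'S EIGEN CLASSES LIVE OVER `ℚ` —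
# finite-level `τ`-eigen classes of `H¹(K, E[p^M])` inside `H¹(ℚ, E[p^∞])` / `H¹(ℚ, E^{(c)}[p^∞])`
# (PROVED)

Helper (seat `bsd-line-gk2-p3` g10, cell `bsd-f1-sign2`; `--supports` the item, closes nothing): the
FINITE-LEVEL bridge of the eigen/`ℚ_ℓ` architecture for Q3 (memo Q3-ARCH v2, evidence #6 on the
item), sequel to `…QuadInfResTwist` (S1(±) at the `p^∞` level, intrinsic model).

Kolyvagin's classes `c_M(n) ∈ H¹(K, E[p^M])` (`KolyvaginHeegnerData.kolyvaginClass`) are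
`τ`-EIGEN: `τ c_M(n) = ε_n c_M(n)`, `ε_n = ε·(−1)^{#n}` (Gross 1991 Prop. 5.4 (2); tree:
`conjAct_kolyvaginClass_eq_smul`, in the currency `conjAct W σ₀ n` of `SelmerGaloisAction`). The
tree reads finite-level classes inside `H¹(K, E[p^∞])` through
`torsionPowToPrimaryH1 : H¹(K, E[p^M]) → H¹(K, E[p^∞])` (`SelmerLevelToPrimary`; W. Zhang 2014,
p. 248), injective when `E(K)[p] = 0`. This file proves:

* §1 `torsionPowToPrimaryH1_conjH1` / `_conjAct` — the level map INTERTWINES the `Gal(K/ℚ)`-actions: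
  `ι (σ_* x) = σ_* (ι x)` for `ι = torsionPowToPrimaryH1`, `σ_*` = `conjAct W σ (p^M)` on
  `H¹(K, E[p^M])` and `(isLiftOfAut_liftAut σ).conjH1Primary W p` on `H¹(K, E[p^∞])` (both are maps
  of compatible pairs along the same lift; any field `K ⊇ ℚ`, any `σ ∈ Aut(K/ℚ)`).
* §2 for `K = ℚ(θ)`, `θ² = c` quadratic and `E(K)[p] = 0`: a `τ`-INVARIANT class
  `x ∈ H¹(K, E[p^M])` is, inside `H¹(K, E[p^∞])`, the restriction of a UNIQUE class of
  `H¹(ℚ, E[p^∞])` (`existsUnique_resPrimary_eq_of_conjAct_eq`); a `τ`-ANTI-invariant one is the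
  image of a UNIQUE class of `H¹(ℚ, E^{(c)}[p^∞])` under `hPsiK ∘ res`
  (`existsUnique_twist_eq_of_conjAct_eq_neg`); the `ε • x` form used by the tree's Kolyvagin files
  (`…_of_conjAct_eq_smul`); and `ι` is injective (`E(K)[p] = 0`), so nothing is lost.
* §3 the habitat of Q3 (`p = 2`, `ρ̄_{E,2}` onto, `K` quadratic): all hypotheses discharged BY NAME
  (`forall_two_nsmul_baseChange_of_hasSurjectiveModNGaloisRep_two_of_finrank_eq_two`,
  `torsionBy_two_baseChange_eq_bot_of_hasSurjectiveModNGaloisRep_two`): every `τ`-eigen class of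
  `H¹(K, E[2^M])` — in particular every Kolyvagin class `c_M(n)` on `Δ(E) < 0` — IS a class over
  `ℚ` of `E` (sign `+`) or of the twin `E^K` (sign `−`), uniquely, at the `2^∞` level. This is the
  transfer that lets McCallum §5 be run OVER `ℚ` at `2` (Q3-ARCH v2 §4; g9's `…Descent` §5).

Everything is PROVED from tree theorems (no named fact, no definition, no `sorry`, standard axioms).
BSD is not proved by any of this.

References: [GrossLMS1991] §5 (5.1), Prop. 5.4 (2); [McCallumLMS1991] §5 (`c_M(n) ∈ H¹(K, E_{p^M})^{ε}`);
[WZhang2014] p. 248; [Dokchitser2013ParityNotes] §4; V. A. Kolyvagin, *On the structure of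
Shafarevich–Tate groups* (LNM 1479, 1991; cite only): the structure theorem over `ℚ` for `E` and
`E^D` separately.
-/

set_option autoImplicit false
set_option linter.dupNamespace false -- tree convention: `Summit.BirchSwinnertonDyer.BirchSwinnertonDyer.Theorems` (summit = sub-problem)

noncomputable section

open scoped Classical

namespace Summit.BirchSwinnertonDyer.BirchSwinnertonDyer.Theorems.GenusExact.EigenClasses

open WeierstrassCurve Literature.NumberTheory.EllipticCurves
open Summit.BirchSwinnertonDyer.BirchSwinnertonDyer.Theorems.GenusExact.QuadInfResTwist

universe u

/-! ## §1 The level map `H¹(K, E[p^M]) → H¹(K, E[p^∞])` intertwines the `Gal(K/ℚ)`-actions -/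

section Intertwine

variable {K : Type u} [Field K] [CharZero K] (W : WeierstrassCurve ℚ) (p : ℕ)
  {σ : K ≃ₐ[ℚ] K} {τ : AlgebraicClosure K ≃+* AlgebraicClosure K}

/-- The finite-level action of a lift is the map of the compatible pair `(conjGalCMH, torsionMap)`
in the tree's `resH1Hom` spelling (definitional). [folklore] -/
theorem conjH1_eq_resH1Hom (hτ : IsLiftOfAut σ τ) (n : ℤ) :
    hτ.conjH1 W n = resH1Hom hτ.conjGalCMH (hτ.torsionMap W n) (hτ.torsionMap_smul W n) :=
  rfl

/-- **`ι ∘ τ_* = τ_* ∘ ι`** for `ι = torsionPowToPrimaryH1 : H¹(K, E[p^M]) → H¹(K, E[p^∞])` and the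
actions of ONE lift `τ` of `σ ∈ Aut(K/ℚ)` at the two levels (`IsLiftOfAut.conjH1`,
`IsLiftOfAut.conjH1Primary`): both composites are the map of the compatible pair
`(conjGalCMH, E[p^M] ↪ E[p^∞] → E[p^∞])`, `P ↦ τP`. [cite: GrossLMS1991, §5 (5.1)]
[cite: SerreGaloisCohomology1997, I §2.4] -/
theorem torsionPowToPrimaryH1_conjH1 (hτ : IsLiftOfAut σ τ) (M : ℕ)
    (x : galH1Torsion (W.baseChange K) ((p ^ M : ℕ) : ℤ)) :
    torsionPowToPrimaryH1 (W.baseChange K) p M (hτ.conjH1 W ((p ^ M : ℕ) : ℤ) x) =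
      hτ.conjH1Primary W p (torsionPowToPrimaryH1 (W.baseChange K) p M x) := by
  rw [conjH1_eq_resH1Hom, torsionPowToPrimaryH1, IsLiftOfAut.conjH1Primary, resH1Hom_resH1Hom,
    resH1Hom_resH1Hom]
  exact congrFun (congrArg DFunLike.coe (resH1Hom_congr (by ext; rfl)
    (AddMonoidHom.ext fun P ↦ Subtype.ext rfl) _ _)) x

/-- **`ι ∘ σ_* = σ_* ∘ ι` in the `conjAct` currency** of the tree's Kolyvagin files
(`conjAct W σ n = (isLiftOfAut_liftAut σ).conjH1 W n`). [cite: GrossLMS1991, §5 (5.1)] -/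
theorem torsionPowToPrimaryH1_conjAct (σ : K ≃ₐ[ℚ] K) (M : ℕ)
    (x : galH1Torsion (W.baseChange K) ((p ^ M : ℕ) : ℤ)) :
    torsionPowToPrimaryH1 (W.baseChange K) p M (conjAct W σ ((p ^ M : ℕ) : ℤ) x) =
      (isLiftOfAut_liftAut σ).conjH1Primary W p (torsionPowToPrimaryH1 (W.baseChange K) p M x) :=
  torsionPowToPrimaryH1_conjH1 W p (isLiftOfAut_liftAut σ) M x

/-- The `ε • x` form: `ι (σ_* x) = σ_* (ι x)` turns `σ_* x = ε • x` into `σ_* (ι x) = ε • ι x`.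
[cite: GrossLMS1991, Prop. 5.4 (2)] -/
theorem conjH1Primary_torsionPowToPrimaryH1_of_conjAct_eq_smul (σ : K ≃ₐ[ℚ] K) (M : ℕ)
    {x : galH1Torsion (W.baseChange K) ((p ^ M : ℕ) : ℤ)} {e : ℤ}
    (hx : conjAct W σ ((p ^ M : ℕ) : ℤ) x = e • x) :
    (isLiftOfAut_liftAut σ).conjH1Primary W p (torsionPowToPrimaryH1 (W.baseChange K) p M x) =
      e • torsionPowToPrimaryH1 (W.baseChange K) p M x := by
  rw [← torsionPowToPrimaryH1_conjAct, hx, map_zsmul]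

end Intertwine

/-! ## §2 `K = ℚ(θ)` quadratic, `E(K)[p] = 0`: eigen classes of `H¹(K, E[p^M])` come from `ℚ` -/

section Quadratic

variable (W : WeierstrassCurve ℚ) (K : Type) [Field K] [NumberField K] (h2 : Module.finrank ℚ K = 2)
  {θ : K} {c : ℚ} (hθ : θ ∉ Set.range (algebraMap ℚ K)) (hc : θ ^ 2 = algebraMap ℚ K c) (p M : ℕ)

include h2 in
/-- **A `τ`-invariant class of `H¹(K, E[p^M])` is a class over `ℚ`**: with `E(K)[p] = 0`, if
`τ_* x = x` (`conjAct` of `σ₀ : θ ↦ −θ`) then `ι x ∈ H¹(K, E[p^∞])` is the restriction of a UNIQUE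
`η ∈ H¹(ℚ, E[p^∞])`. For Kolyvagin's `c_M(n)` with `ε_n = +1`.
[cite: McCallumLMS1991, §5 (c_M(n) ∈ H¹(K, E_{p^M})^{ε})] [cite: GrossLMS1991, §5 (5.1)] -/
theorem existsUnique_resPrimary_eq_of_conjAct_eq
    (hL : ∀ P : (W.baseChange K).toAffine.Point, p • P = 0 → P = 0)
    {x : galH1Torsion (W.baseChange K) ((p ^ M : ℕ) : ℤ)}
    (hx : conjAct W (sigmaQ K h2 hθ hc) ((p ^ M : ℕ) : ℤ) x = x) :
    ∃! η : galH1Primary W p, resPrimary W K p η = torsionPowToPrimaryH1 (W.baseChange K) p M x := by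
  have hT := resPrimary_injective_and_range_eq_fixed W K h2 hθ hc p hL
  have hfix : (isLiftOfAut_liftAut (sigmaQ K h2 hθ hc)).conjH1Primary W p
      (torsionPowToPrimaryH1 (W.baseChange K) p M x) =
        torsionPowToPrimaryH1 (W.baseChange K) p M x := by
    rw [← torsionPowToPrimaryH1_conjAct, hx]
  obtain ⟨η, hη⟩ := (hT.2 _).2 hfix
  exact ⟨η, hη, fun η' hη' ↦ hT.1 (hη'.trans hη.symm)⟩

include h2 in
/-- **A `τ`-ANTI-invariant class of `H¹(K, E[p^M])` is a class over `ℚ` of the twist**: with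
`E(K)[p] = 0`, if `τ_* x = −x` then `ι x` is `hPsiK (res η')` for a UNIQUE
`η' ∈ H¹(ℚ, E^{(c)}[p^∞])`. For Kolyvagin's `c_M(n)` with `ε_n = −1`.
[cite: McCallumLMS1991, §5 (c_M(n) ∈ H¹(K, E_{p^M})^{ε})]
[cite: Dokchitser2013ParityNotes, §4, proof of the Theorem "[Squarity, NekIV, Kurast]"] -/
theorem existsUnique_twist_eq_of_conjAct_eq_neg
    (hL : ∀ P : (W.baseChange K).toAffine.Point, p • P = 0 → P = 0)
    {x : galH1Torsion (W.baseChange K) ((p ^ M : ℕ) : ℤ)}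
    (hx : conjAct W (sigmaQ K h2 hθ hc) ((p ^ M : ℕ) : ℤ) x = -x) :
    ∃! η' : galH1Primary (W.quadraticTwist c) p,
      hPsiK W K hθ hc p (resPrimary (W.quadraticTwist c) K p η') =
        torsionPowToPrimaryH1 (W.baseChange K) p M x := by
  have hT := resPrimary_twist_injective_and_range_eq_antifixed W K h2 hθ hc p hL
  have hanti : (isLiftOfAut_liftAut (sigmaQ K h2 hθ hc)).conjH1Primary W p
      (torsionPowToPrimaryH1 (W.baseChange K) p M x) =
        -torsionPowToPrimaryH1 (W.baseChange K) p M x := by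
    rw [← torsionPowToPrimaryH1_conjAct, hx, map_neg]
  obtain ⟨η', hη'⟩ := (hT.2 _).2 hanti
  exact ⟨η', hη', fun η'' hη'' ↦ hT.1 ((hPsiK W K hθ hc p).injective (hη''.trans hη'.symm))⟩

include h2 in
/-- **The `ε • x` dichotomy** (the shape `∃ e, (e = 1 ∨ e = −1) ∧ τ_* x = e • x` of the tree's
Kolyvagin files): with `E(K)[p] = 0`, an eigen class of sign `+1` comes from `H¹(ℚ, E[p^∞])`, one
of sign `−1` from `H¹(ℚ, E^{(c)}[p^∞])`. [cite: GrossLMS1991, Prop. 5.4 (2)]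
[cite: McCallumLMS1991, §5] -/
theorem eigenclass_from_rat_of_conjAct_eq_smul
    (hL : ∀ P : (W.baseChange K).toAffine.Point, p • P = 0 → P = 0)
    {x : galH1Torsion (W.baseChange K) ((p ^ M : ℕ) : ℤ)} {e : ℤ} (he : e = 1 ∨ e = -1)
    (hx : conjAct W (sigmaQ K h2 hθ hc) ((p ^ M : ℕ) : ℤ) x = e • x) :
    (e = 1 ∧ ∃! η : galH1Primary W p,
        resPrimary W K p η = torsionPowToPrimaryH1 (W.baseChange K) p M x) ∨
      (e = -1 ∧ ∃! η' : galH1Primary (W.quadraticTwist c) p,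
        hPsiK W K hθ hc p (resPrimary (W.quadraticTwist c) K p η') =
          torsionPowToPrimaryH1 (W.baseChange K) p M x) := by
  rcases he with rfl | rfl
  · rw [one_smul] at hx
    exact Or.inl ⟨rfl, existsUnique_resPrimary_eq_of_conjAct_eq W K h2 hθ hc p M hL hx⟩
  · rw [neg_one_zsmul] at hx
    exact Or.inr ⟨rfl, existsUnique_twist_eq_of_conjAct_eq_neg W K h2 hθ hc p M hL hx⟩

/-- **Nothing is lost at the `p^∞` level**: with `E(K)[p] = 0` the level map
`ι : H¹(K, E[p^M]) → H¹(K, E[p^∞])` is injective (the tree's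
`torsionPowToPrimaryH1_injective_of_torsionBy_eq_bot`, hypothesis spelled with `p • P`).
[cite: WZhang2014, p. 248] [cite: GrossLMS1991, §4] -/
theorem torsionPowToPrimaryH1_injective_of_noTorsion
    (hL : ∀ P : (W.baseChange K).toAffine.Point, p • P = 0 → P = 0) :
    Function.Injective (torsionPowToPrimaryH1 (W.baseChange K) p M) := by
  refine torsionPowToPrimaryH1_injective_of_torsionBy_eq_bot (W.baseChange K) p M ?_
  rw [eq_bot_iff]
  intro P hP
  rw [AddSubgroup.mem_bot]
  exact hL P (AddSubgroup.torsionBy.nsmul_iff.mp hP)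

end Quadratic

/-! ## §3 The habitat of Q3: `p = 2`, `ρ̄_{E,2}` onto, any non-trivial `c ∈ Aut(K/ℚ)` -/

section Habitat

variable (W : WeierstrassCurve ℚ) [W.IsElliptic] (K : Type) [Field K] [NumberField K]
  (h2 : Module.finrank ℚ K = 2) {θ : K} {c : ℚ} (hθ : θ ∉ Set.range (algebraMap ℚ K))
  (hc : θ ^ 2 = algebraMap ℚ K c) (M : ℕ)

include h2 in
/-- **Kolyvagin's eigen classes at `2` live over `ℚ` — the habitat statement.** For `E/ℚ` with
`ρ̄_{E,2}` onto, a quadratic field `K = ℚ(θ)`, `θ² = c`, ANY non-trivial `τ ∈ Aut(K/ℚ)` (the items'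
binder `c ≠ 1`; `τ = σ₀` by the tree's `algEquiv_eq_of_ne_one_of_finrank_eq_two`), a level `2^M` and a class `x ∈ H¹(K, E[2^M])` with `τ_* x = e • x`, `e = ±1`
(the shape of `conjAct_kolyvaginClass_eq_smul`, Gross Prop. 5.4 (2)): the level map
`ι : H¹(K, E[2^M]) ↪ H¹(K, E[2^∞])` is injective, and `ι x` is the restriction of a UNIQUE class of
`H¹(ℚ, E[2^∞])` if `e = 1`, resp. `hPsiK (res η')` for a UNIQUE `η' ∈ H¹(ℚ, E^{(c)}[2^∞])` if
`e = −1`. Hypothesis `E(K)[2] = 0` discharged by the tree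
(`forall_two_nsmul_baseChange_of_hasSurjectiveModNGaloisRep_two_of_finrank_eq_two`). So on
`Δ(E) < 0` every Kolyvagin class `c_M(n)` is a class OVER `ℚ` of `E` (`ε_n = +1`) or of the twin
`E^K ≅ E^{(c)}` (`ε_n = −1`) — the transfer of Q3-ARCH v2 §4. BSD is not proved by this.
[cite: GrossLMS1991, §5 (5.1), Prop. 5.4 (2)] [cite: McCallumLMS1991, §5]
[cite: DokchitserDokchitserMathZ2012, Theorem (1)] -/
theorem eigenclass_two_from_rat (hs : W.HasSurjectiveModNGaloisRep 2) {τ : K ≃ₐ[ℚ] K}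
    (hτ : τ ≠ 1) {x : galH1Torsion (W.baseChange K) ((2 ^ M : ℕ) : ℤ)} {e : ℤ}
    (he : e = 1 ∨ e = -1) (hx : conjAct W τ ((2 ^ M : ℕ) : ℤ) x = e • x) :
    Function.Injective (torsionPowToPrimaryH1 (W.baseChange K) 2 M) ∧
      ((e = 1 ∧ ∃! η : galH1Primary W 2,
          resPrimary W K 2 η = torsionPowToPrimaryH1 (W.baseChange K) 2 M x) ∨
        (e = -1 ∧ ∃! η' : galH1Primary (W.quadraticTwist c) 2,
          hPsiK W K hθ hc 2 (resPrimary (W.quadraticTwist c) K 2 η') =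
            torsionPowToPrimaryH1 (W.baseChange K) 2 M x)) := by
  have hL : ∀ P : (W.baseChange K).toAffine.Point, 2 • P = 0 → P = 0 :=
    forall_two_nsmul_baseChange_of_hasSurjectiveModNGaloisRep_two_of_finrank_eq_two W hs K h2
  have hτσ : τ = sigmaQ K h2 hθ hc :=
    SchneiderFree.KYRead.LogDescent.algEquiv_eq_of_ne_one_of_finrank_eq_two h2 hτ
      (sigmaQ_ne_one K h2 hθ hc)
  subst hτσ
  exact ⟨torsionPowToPrimaryH1_injective_of_noTorsion W K 2 M hL,
    eigenclass_from_rat_of_conjAct_eq_smul W K h2 hθ hc 2 M hL he hx⟩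

/-- **The same in the items' binder currency** (`∀ n > 0, HasSurjectiveModNGaloisRep (2^n)` at
`n = 1`; `IsImaginaryQuadratic K`). [cite: GrossLMS1991, §5 (5.1), Prop. 5.4 (2)] -/
theorem eigenclass_two_from_rat_of_habitat
    (hρ : ∀ n : ℕ, 0 < n → W.HasSurjectiveModNGaloisRep ((2 : ℤ) ^ n))
    (hK : IsImaginaryQuadratic K) {θ : K} {c : ℚ} (hθ : θ ∉ Set.range (algebraMap ℚ K))
    (hc : θ ^ 2 = algebraMap ℚ K c) {τ : K ≃ₐ[ℚ] K} (hτ : τ ≠ 1)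
    {x : galH1Torsion (W.baseChange K) ((2 ^ M : ℕ) : ℤ)} {e : ℤ}
    (he : e = 1 ∨ e = -1) (hx : conjAct W τ ((2 ^ M : ℕ) : ℤ) x = e • x) :
    Function.Injective (torsionPowToPrimaryH1 (W.baseChange K) 2 M) ∧
      ((e = 1 ∧ ∃! η : galH1Primary W 2,
          resPrimary W K 2 η = torsionPowToPrimaryH1 (W.baseChange K) 2 M x) ∨
        (e = -1 ∧ ∃! η' : galH1Primary (W.quadraticTwist c) 2,
          hPsiK W K hθ hc 2 (resPrimary (W.quadraticTwist c) K 2 η') =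
            torsionPowToPrimaryH1 (W.baseChange K) 2 M x)) := by
  have hs : W.HasSurjectiveModNGaloisRep 2 := by simpa using hρ 1 one_pos
  exact eigenclass_two_from_rat W K hK.1 hθ hc M hs hτ he hx

end Habitat

end Summit.BirchSwinnertonDyer.BirchSwinnertonDyer.Theorems.GenusExact.EigenClasses

end
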